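import Literature.MathematicalPhysics.QuantumFieldTheory.Balaban1983to89.LatticeWordStokes
import Literature.MathematicalPhysics.QuantumFieldTheory.Balaban1983to89.B10Eq27TorusAxialLog
import HarnessLib

/-!
# Route `UnitScaleTilt`, crux K1 child «MinimiserStabilityRegPr» (stmt-QuantumFields-19200), skeleton v10, stub `stub_existenceMinimalOrbit` (EX), route (α) —
# **(ROW-R2q″, FILE 2a) THE LADDER STOKES BOUND IN AREA FORM**: two staircase transports from the same base point to NEIGHBOURING end points `x`, `x + e_μ`, closed up by
# the bond `[x, x + e_μ]`, differ from `1` by at most **`(d·N)·δ`** — LINEAR in the stair length — under `PlaqSmall δ` (`|n_ν| ≤ N`), whereas the tree's perimeter-form Stokes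
# (✓`LatticeWordStokes.dist1_holAt_le`, ✓`Prop7TwoWordStokes.dist1_holAt_inv_mul_holAt_le`, ✓`Prop7TowerClosenessOfRegPr.dist1_holT_stair_mul_inv_stair_le`) gives `O((dN)²)·δ`.

WHY (LOCATE memo `pub/ym3-torus/ym3-torus-px10/LOCATE-R2q-px10g2.md` §4 (F1-ladder)).  The extension `S c = χ·Ad_{P x}c(block)` of the (P2-core) plan v2 (R2q″) frames the constant by the
STAIR transport `P x` from the top-block centre (`|n_ν| ≤ L^k∕2`); its covariant gradient at a fine bond `b = [x, x+e_μ]` is `η⁻¹·Ad(χ(Ad_{a(b)} − 1)c + …)` with `a(b)` exactly the ladder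
holonomy of this file, so the H¹ row of `S` is η-FREE iff `dist1 (a(b)) = O(L^k)·ε₀η² = O(ε₀η)` — the AREA form (`L^k·η = 1`); the perimeter form `O(L^{2k})·ε₀η² = O(ε₀)` loses `η⁻¹`.
The mechanism is ★p1's cancellation calculus ✓`LatticeWordStokes.dist1_holAt_cancel_le` («moving `m̄` leftward through `B` to its partner costs `|B|` plaquettes») applied ONCE: the
ladder word is `A m B m̄ C` with `A B C` a pure backtrack.

Cell `ym3-torus`, width seat `ym3-torus-px10` (gen 2).  THEOREMS ONLY (0 `def`, 0 `sorry`).  `--supports stmt-QuantumFields-19200 --as helper`, count-neutral.  YM₃ on T³ is a ladder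
rung (R3), not the Clay problem; nothing here claims the stub, the crux, d = 4 or the mass gap.

WHAT IS PROVED (sorry-free, no definition; ns `…Theorems.Prop7StairLadderStokes`; any `Params P`, level `j`, `GaugeGroup G`):
* §1 words: `holAt_walk_append_wordRev` (`U(w ++ (−w)) = 1`), `axisRun_succ_of_nonneg`, `axisRun_eq_cons_of_neg`, `stairRuns_congr`,
  ★`stairRuns_decomp_of_nonneg`∕`stairRuns_decomp_of_neg` and ★`stairWord_decomp_of_nonneg`∕`stairWord_decomp_of_neg` — raising `n_μ` by one INSERTS the letter `+e_μ` at the head of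
  the `μ`-run (or DELETES the head letter `−e_μ`), all other runs unchanged;
* §2 ★★`dist1_holAt_insert_le` — `dist1 U(w₁ w₂ m · −(w₁ m w₂)) ≤ |w₂|·δ`; ★★`dist1_holAt_remove_le` — `dist1 U(w₁ m w₂ m̄ · −(w₁ w₂)) ≤ |w₂|·δ`;
* §3 the same for the torus transports `holT`: ★★`dist1_holT_mul_inv_le_of_insert`∕`_of_remove` (`dist1 (V(w ++ [m])·V(w′)⁻¹)`, `w′` = `w` with `m` inserted ∕ `m̄` removed);
* §4 ★★★`dist1_holT_stair_ladder_le` — for `n′ = n + e_μ` (`|n_ν| ≤ N`): `dist1 (holT V x (stairWord σ n ++ [(μ,true)]) · (holT V x (stairWord σ n′))⁻¹) ≤ (d·N)·δ`.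
HONEST SCOPE: pure lattice word calculus on ★p1's letters; constants crude (`|w₂| ≤ |stairWord| ≤ dN`; the true area is the length of the runs AFTER the `μ`-run); nothing of print asserted.

References: T. Bałaban, CMP 98 (1985) 17–51 [Balaban1985Averaging] ((9) p.18, (19)–(20) p.21, (58) p.27); CMP 109 (1987) 249–301 [Balaban1987RG1] ((0.3)–(0.4) pp.252–253).
-/

set_option autoImplicit false

namespace Summit.QuantumFields.YangMills.Theorems.Prop7StairLadderStokes

open Literature.MathematicalPhysics.QuantumFieldTheory.Balaban1983to89
open T4Continuum T4ReflectionCone BlockAveraging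
open B10Eq27TorusAxialLog (holT holT_eq_holAt)
open LatticeWordStokes (dist1_holAt_cancel_le length_stairWord_le)

variable {P : Params} {j : ℕ} {G : Type*} [GaugeGroup G]

/-! ## §1 Words: reversal length, backtracks, and the effect of `n ↦ n + e_μ` on a staircase -/

section Words

variable {d : ℕ}

/-- For `k ≥ 0` the run of `k + 1` letters `+e_μ` is `+e_μ` followed by the run of `k`. [cite: Balaban1987RG1, (0.3) p.252] -/
theorem axisRun_succ_of_nonneg (μ : Fin d) {k : ℤ} (hk : 0 ≤ k) : axisRun μ (k + 1) = (μ, true) :: axisRun μ k := by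
  obtain ⟨m, rfl⟩ := Int.eq_ofNat_of_zero_le hk
  have h1 : ((m : ℤ) + 1).natAbs = m + 1 := by omega
  have h2 : (0 : ℤ) ≤ (m : ℤ) + 1 := by omega
  simp only [axisRun, h1, Int.natAbs_natCast, decide_eq_true h2, decide_eq_true hk, List.replicate_succ]

/-- For `k < 0` the run of `|k|` letters `−e_μ` is `−e_μ` followed by the run of `k + 1`. [cite: Balaban1987RG1, (0.3) p.252] -/
theorem axisRun_eq_cons_of_neg (μ : Fin d) {k : ℤ} (hk : k < 0) : axisRun μ k = (μ, false) :: axisRun μ (k + 1) := by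
  obtain ⟨m, rfl⟩ := Int.eq_negSucc_of_lt_zero hk
  have h1 : (Int.negSucc m).natAbs = m + 1 := rfl
  have h2 : ¬ (0 : ℤ) ≤ Int.negSucc m := not_le.mpr hk
  rcases Nat.eq_zero_or_pos m with hm | hm
  · subst hm
    simp [axisRun]
  · have h3 : Int.negSucc m + 1 = Int.negSucc (m - 1) := by
      rw [Int.negSucc_eq, Int.negSucc_eq]; omega
    have h4 : (Int.negSucc (m - 1)).natAbs = m := by rw [Int.natAbs_negSucc]; omega
    have h5 : ¬ (0 : ℤ) ≤ Int.negSucc (m - 1) := not_le.mpr (Int.negSucc_lt_zero _)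
    rw [axisRun, axisRun, h3, h1, h4, decide_eq_false h2, decide_eq_false h5, List.replicate_succ]

/-- Staircase runs through a list of axes only read `n` on those axes. [folklore] -/
theorem stairRuns_congr (n n' : Fin d → ℤ) : ∀ (as : List (Fin d)), (∀ a ∈ as, n' a = n a) → stairRuns n' as = stairRuns n as
  | [], _ => rfl
  | a :: as, h => by
    rw [stairRuns, stairRuns, h a List.mem_cons_self, stairRuns_congr n n' as fun b hb => h b (List.mem_cons_of_mem a hb)]

/-- ★ Raising `n_μ ≥ 0` by one inserts the letter `+e_μ` at the head of the `μ`-run and leaves the rest of the staircase unchanged. [cite: Balaban1987RG1, (0.3) p.252] -/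
theorem stairRuns_decomp_of_nonneg (n n' : Fin d → ℤ) (μ : Fin d) (hn' : ∀ ν, ν ≠ μ → n' ν = n ν) (hμ : n' μ = n μ + 1) (h0 : 0 ≤ n μ) :
    ∀ (as : List (Fin d)), as.Nodup → μ ∈ as →
      ∃ w₁ w₂ : List (Letter d), stairRuns n as = w₁ ++ w₂ ∧ stairRuns n' as = w₁ ++ (μ, true) :: w₂
  | [], _, h => absurd h List.not_mem_nil
  | a :: as, hnd, hmem => by
    rw [List.nodup_cons] at hnd
    by_cases ha : a = μ
    · subst ha
      refine ⟨[], axisRun a (n a) ++ stairRuns n as, by rw [stairRuns, List.nil_append], ?_⟩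
      rw [stairRuns, hμ, axisRun_succ_of_nonneg a h0, List.nil_append, List.cons_append,
        stairRuns_congr n n' as fun b hb => hn' b (fun hba => hnd.1 (hba ▸ hb))]
    · have hmem' : μ ∈ as := by
        rcases List.mem_cons.mp hmem with h | h
        · exact absurd h.symm ha
        · exact h
      obtain ⟨w₁, w₂, h₁, h₂⟩ := stairRuns_decomp_of_nonneg n n' μ hn' hμ h0 as hnd.2 hmem'
      refine ⟨axisRun a (n a) ++ w₁, w₂, by rw [stairRuns, h₁, List.append_assoc], ?_⟩
      rw [stairRuns, h₂, hn' a ha, List.append_assoc]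

/-- ★ Raising `n_μ < 0` by one deletes the head letter `−e_μ` of the `μ`-run and leaves the rest of the staircase unchanged. [cite: Balaban1987RG1, (0.3) p.252] -/
theorem stairRuns_decomp_of_neg (n n' : Fin d → ℤ) (μ : Fin d) (hn' : ∀ ν, ν ≠ μ → n' ν = n ν) (hμ : n' μ = n μ + 1) (h0 : n μ < 0) :
    ∀ (as : List (Fin d)), as.Nodup → μ ∈ as →
      ∃ w₁ w₂ : List (Letter d), stairRuns n as = w₁ ++ (μ, false) :: w₂ ∧ stairRuns n' as = w₁ ++ w₂
  | [], _, h => absurd h List.not_mem_nil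
  | a :: as, hnd, hmem => by
    rw [List.nodup_cons] at hnd
    by_cases ha : a = μ
    · subst ha
      refine ⟨[], axisRun a (n a + 1) ++ stairRuns n as, ?_, ?_⟩
      · rw [stairRuns, axisRun_eq_cons_of_neg a h0, List.nil_append, List.cons_append]
      · rw [stairRuns, hμ, List.nil_append, stairRuns_congr n n' as fun b hb => hn' b (fun hba => hnd.1 (hba ▸ hb))]
    · have hmem' : μ ∈ as := by
        rcases List.mem_cons.mp hmem with h | h
        · exact absurd h.symm ha
        · exact h
      obtain ⟨w₁, w₂, h₁, h₂⟩ := stairRuns_decomp_of_neg n n' μ hn' hμ h0 as hnd.2 hmem'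
      refine ⟨axisRun a (n a) ++ w₁, w₂, by rw [stairRuns, h₁, List.append_assoc], ?_⟩
      rw [stairRuns, h₂, hn' a ha, List.append_assoc]

/-- ★ The staircase word `Γ_σ(n + e_μ)` is `Γ_σ(n)` with ONE letter `+e_μ` inserted (case `n_μ ≥ 0`); the tail after the insertion point is no longer than `Γ_σ(n)`.
[cite: Balaban1987RG1, (0.3) p.252] -/
theorem stairWord_decomp_of_nonneg (σ : Equiv.Perm (Fin d)) (n n' : Fin d → ℤ) (μ : Fin d) (hn' : ∀ ν, ν ≠ μ → n' ν = n ν) (hμ : n' μ = n μ + 1)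
    (h0 : 0 ≤ n μ) : ∃ w₁ w₂ : List (Letter d), stairWord σ n = w₁ ++ w₂ ∧ stairWord σ n' = w₁ ++ (μ, true) :: w₂ :=
  stairRuns_decomp_of_nonneg n n' μ hn' hμ h0 _ (nodup_finRange_map σ) (mem_finRange_map σ μ)

/-- ★ The staircase word `Γ_σ(n + e_μ)` is `Γ_σ(n)` with its letter `−e_μ` at the head of the `μ`-run deleted (case `n_μ < 0`). [cite: Balaban1987RG1, (0.3) p.252] -/
theorem stairWord_decomp_of_neg (σ : Equiv.Perm (Fin d)) (n n' : Fin d → ℤ) (μ : Fin d) (hn' : ∀ ν, ν ≠ μ → n' ν = n ν) (hμ : n' μ = n μ + 1)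
    (h0 : n μ < 0) : ∃ w₁ w₂ : List (Letter d), stairWord σ n = w₁ ++ (μ, false) :: w₂ ∧ stairWord σ n' = w₁ ++ w₂ :=
  stairRuns_decomp_of_neg n n' μ hn' hμ h0 _ (nodup_finRange_map σ) (mem_finRange_map σ μ)

end Words

/-! ## §2 The ladder bound for walks (`holAt`) -/

section Walks

variable (U : GaugeField P j G)

/-- A walk followed by its own reversal transports by `1`. [cite: Balaban1985Averaging, (9) p.18] -/
theorem holAt_walk_append_wordRev (x : Site P j) (w : List (Letter P.d)) : holAt U (walk x (w ++ wordRev w)) = 1 := by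
  rw [walk_append, holAt_append, holAt_walk_wordRev, mul_inv_cancel]

/-- ★★ **INSERTING ONE LETTER COSTS THE LENGTH OF THE TAIL**: for words `w₁ w₂` and a letter `m`, the closed word `w₁ w₂ m · −(w₁ m w₂)` (out along `w₁ w₂`, the extra step `m`,
back along the word with `m` inserted after `w₁`) has `dist1 ≤ |w₂|·δ` under `PlaqSmall δ U` — `m` is moved back through `−w₂` to cancel its partner `m̄`
(✓`LatticeWordStokes.dist1_holAt_cancel_le`), and what remains is a pure backtrack. [cite: Balaban1985Averaging, (19)-(20) p.21] -/
theorem dist1_holAt_insert_le {δ : ℝ} (hδ : 0 ≤ δ) (hU : PlaqSmall δ U) (x : Site P j) (w₁ w₂ : List (Letter P.d)) (m : Letter P.d) :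
    dist1 (holAt U (walk x (w₁ ++ w₂ ++ m :: wordRev (w₁ ++ m :: w₂)))) ≤ (w₂.length : ℝ) * δ := by
  have hw : w₁ ++ w₂ ++ m :: wordRev (w₁ ++ m :: w₂) = (w₁ ++ w₂) ++ m :: (wordRev w₂ ++ m.flip :: wordRev w₁) := by
    rw [wordRev_append, wordRev_cons]
    simp only [List.append_assoc, List.cons_append, List.nil_append]
  have hback : (w₁ ++ w₂) ++ (wordRev w₂ ++ wordRev w₁) = (w₁ ++ w₂) ++ wordRev (w₁ ++ w₂) := by rw [wordRev_append]
  rw [hw]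
  refine (dist1_holAt_cancel_le U hδ hU x m (wordRev w₂) (w₁ ++ w₂) (wordRev w₁)).trans ?_
  have hlen : (wordRev w₂).length = w₂.length := by simp [wordRev]  -- ✓`RegionAxialGauge.length_wordRev`, inlined to keep the imports light
  rw [hback, holAt_walk_append_wordRev, GaugeGroup.dist1_one, add_zero, hlen]

/-- ★★ **DELETING ONE LETTER COSTS THE LENGTH OF THE TAIL**: for words `w₁ w₂` and a letter `m`, the closed word `w₁ m w₂ m̄ · −(w₁ w₂)` has `dist1 ≤ |w₂|·δ` under `PlaqSmall δ U`.
[cite: Balaban1985Averaging, (19)-(20) p.21] -/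
theorem dist1_holAt_remove_le {δ : ℝ} (hδ : 0 ≤ δ) (hU : PlaqSmall δ U) (x : Site P j) (w₁ w₂ : List (Letter P.d)) (m : Letter P.d) :
    dist1 (holAt U (walk x (w₁ ++ m :: w₂ ++ m.flip :: wordRev (w₁ ++ w₂)))) ≤ (w₂.length : ℝ) * δ := by
  have hw : w₁ ++ m :: w₂ ++ m.flip :: wordRev (w₁ ++ w₂) = w₁ ++ m :: (w₂ ++ m.flip :: wordRev (w₁ ++ w₂)) := by
    simp only [List.append_assoc, List.cons_append]
  rw [hw]
  refine (dist1_holAt_cancel_le U hδ hU x m w₂ w₁ (wordRev (w₁ ++ w₂))).trans ?_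
  rw [← List.append_assoc, holAt_walk_append_wordRev, GaugeGroup.dist1_one, add_zero]

end Walks

/-! ## §3 The ladder bound for the torus transports `holT` -/

section Transports

variable (V : GaugeField P j G)

/-- The transport along `w` times the inverse transport along `w′` with the same net displacement is the holonomy of the closed word `w ++ (−w′)`. [cite: Balaban1985Averaging, (9) p.18] -/
theorem holT_mul_holT_inv_eq (x : Site P j) (w w' : List (Letter P.d)) (h : ∀ ν, netDisp w ν = netDisp w' ν) :
    holT V x w * (holT V x w')⁻¹ = holAt V (walk x (w ++ wordRev w')) := by
  have hend : walkEnd x w = walkEnd x w' := by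
    funext ν; rw [walkEnd_apply, walkEnd_apply, h ν]
  rw [holT_eq_holAt, holT_eq_holAt, walk_append, holAt_append, hend, holAt_walk_wordRev]

/-- ★★ `dist1 (V(w₁ w₂ m)·V(w₁ m w₂)⁻¹) ≤ |w₂|·δ` under `PlaqSmall δ V`. [cite: Balaban1985Averaging, (19)-(20) p.21] -/
theorem dist1_holT_mul_inv_le_of_insert {δ : ℝ} (hδ : 0 ≤ δ) (hV : PlaqSmall δ V) (x : Site P j) (w₁ w₂ : List (Letter P.d)) (m : Letter P.d) :
    dist1 (holT V x (w₁ ++ w₂ ++ [m]) * (holT V x (w₁ ++ m :: w₂))⁻¹) ≤ (w₂.length : ℝ) * δ := by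
  have h : ∀ ν, netDisp (w₁ ++ w₂ ++ [m]) ν = netDisp (w₁ ++ m :: w₂) ν := by
    intro ν
    rw [netDisp_append, netDisp_append, netDisp_append, netDisp_cons m w₂]
    rw [show netDisp [m] ν = netDisp (m :: []) ν from rfl, netDisp_cons, netDisp_nil']
    ring
  rw [holT_mul_holT_inv_eq V x _ _ h]
  have hw : w₁ ++ w₂ ++ [m] ++ wordRev (w₁ ++ m :: w₂) = w₁ ++ w₂ ++ m :: wordRev (w₁ ++ m :: w₂) := by
    simp only [List.append_assoc, List.singleton_append]
  rw [hw]
  exact dist1_holAt_insert_le V hδ hV x w₁ w₂ m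

/-- ★★ `dist1 (V(w₁ m w₂ m̄)·V(w₁ w₂)⁻¹) ≤ |w₂|·δ` under `PlaqSmall δ V`. [cite: Balaban1985Averaging, (19)-(20) p.21] -/
theorem dist1_holT_mul_inv_le_of_remove {δ : ℝ} (hδ : 0 ≤ δ) (hV : PlaqSmall δ V) (x : Site P j) (w₁ w₂ : List (Letter P.d)) (m : Letter P.d) :
    dist1 (holT V x (w₁ ++ m :: w₂ ++ [m.flip]) * (holT V x (w₁ ++ w₂))⁻¹) ≤ (w₂.length : ℝ) * δ := by
  have hflip : ∀ ν, netDisp [m.flip] ν = -netDisp [m] ν := by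
    intro ν
    obtain ⟨a, s⟩ := m
    cases s <;> by_cases ha : a = ν <;> simp [netDisp, Letter.flip, ha]
  have h : ∀ ν, netDisp (w₁ ++ m :: w₂ ++ [m.flip]) ν = netDisp (w₁ ++ w₂) ν := by
    intro ν
    rw [netDisp_append, netDisp_append, netDisp_append, netDisp_cons m w₂, hflip,
      show netDisp [m] ν = netDisp (m :: []) ν from rfl, netDisp_cons, netDisp_nil']
    ring
  rw [holT_mul_holT_inv_eq V x _ _ h]
  have hw : w₁ ++ m :: w₂ ++ [m.flip] ++ wordRev (w₁ ++ w₂) = w₁ ++ m :: w₂ ++ m.flip :: wordRev (w₁ ++ w₂) := by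
    simp only [List.append_assoc, List.cons_append, List.nil_append]
  rw [hw]
  exact dist1_holAt_remove_le V hδ hV x w₁ w₂ m

end Transports

/-! ## §4 Staircases to neighbouring sites: the ladder bound in AREA form -/

section Stairs

variable (V : GaugeField P j G)

/-- ★★★ **THE LADDER STOKES BOUND FOR STAIRCASES, AREA FORM.**  For an ordering `σ` of the axes, offsets `n` and `n′ = n + e_μ` (`n′_ν = n_ν` for `ν ≠ μ`, `n′_μ = n_μ + 1`) with
`|n_ν| ≤ N`, under `PlaqSmall δ V`: the transport along `Γ_σ(n)` followed by the bond `+e_μ`, times the inverse transport along `Γ_σ(n′)`, is within **`(d·N)·δ`** of `1` — the thin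
ladder between the two staircases has at most `|Γ_σ(n)| ≤ dN` rungs (§1: `Γ_σ(n′)` is `Γ_σ(n)` with one letter inserted or deleted at the head of the `μ`-run; §3).  This is the frame
connection `a(b) = P(b₋)⁻¹V(b)P(b₊)` of the stair-framed constant at the bond `b = [x₀ + n, x₀ + n′]`. [cite: Balaban1985Averaging, (19)-(20) p.21, (58) p.27; Balaban1987RG1, (0.3) p.252] -/
theorem dist1_holT_stair_ladder_le {δ : ℝ} (hδ : 0 ≤ δ) (hV : PlaqSmall δ V) (x : Site P j) (σ : Equiv.Perm (Fin P.d)) (n n' : Fin P.d → ℤ) (μ : Fin P.d)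
    (hn' : ∀ ν, ν ≠ μ → n' ν = n ν) (hμ : n' μ = n μ + 1) {N : ℕ} (hN : ∀ ν, (n ν).natAbs ≤ N) :
    dist1 (holT V x (stairWord σ n ++ [(μ, true)]) * (holT V x (stairWord σ n'))⁻¹) ≤ ((P.d : ℝ) * N) * δ := by
  have hlen : ((stairWord σ n).length : ℝ) ≤ (P.d : ℝ) * N := by exact_mod_cast length_stairWord_le σ n N hN
  rcases le_or_gt 0 (n μ) with h0 | h0
  · obtain ⟨w₁, w₂, h₁, h₂⟩ := stairWord_decomp_of_nonneg σ n n' μ hn' hμ h0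
    have hw₂ : (w₂.length : ℝ) ≤ (P.d : ℝ) * N := by
      refine le_trans ?_ hlen
      rw [h₁, List.length_append]; push_cast; linarith
    rw [h₁, h₂]
    exact (dist1_holT_mul_inv_le_of_insert V hδ hV x w₁ w₂ (μ, true)).trans (mul_le_mul_of_nonneg_right hw₂ hδ)
  · obtain ⟨w₁, w₂, h₁, h₂⟩ := stairWord_decomp_of_neg σ n n' μ hn' hμ h0
    have hw₂ : (w₂.length : ℝ) ≤ (P.d : ℝ) * N := by
      refine le_trans ?_ hlen
      rw [h₁, List.length_append, List.length_cons]; push_cast; linarith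
    rw [h₁, h₂]
    have hflip : ((μ, true) : Letter P.d) = Letter.flip (μ, false) := rfl
    rw [hflip]
    exact (dist1_holT_mul_inv_le_of_remove V hδ hV x w₁ w₂ (μ, false)).trans (mul_le_mul_of_nonneg_right hw₂ hδ)

end Stairs

end Summit.QuantumFields.YangMills.Theorems.Prop7StairLadderStokes
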